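import Literature.Analysis.Fourier.SmoothWindow
import Mathlib.Analysis.Fourier.Inversion
import Mathlib.Analysis.Fourier.FourierTransformDeriv
import Mathlib.Analysis.SpecialFunctions.ImproperIntegrals
import Mathlib.MeasureTheory.Group.Integral
import HarnessLib

/-!
# The Fourier kernel of a smooth window: decay, reproducing moments, Plancherel

Topic `Literature/Analysis/Fourier`. For the smooth window `f = smoothWindow a b` of
`SmoothWindow.lean` (`C^∞`, `0 ≤ f ≤ 1`, `f = 1` on `[a+1, b]`, `supp f ⊆ [a, b+1]`) we study the
kernel `F = 𝓕⁻ f`, `F(r) = ∫ f(y) e^{2πiyr} dy` (`windowKernel a b`):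

* decay: `|F(r)| ≤ b + 1 − a` and `|F(r)| ≤ 2 D_k /(2π|r|)^k` for every `k ≥ 1`
  (`norm_windowKernel_le`, `norm_windowKernel_le_div`), via Mathlib's
  `Real.fourier_iteratedDeriv`; hence `(1+|r|)^m |F(r)| ≤ C_m(a,b)/(1+r²)`
  (`pow_mul_norm_windowKernel_le`) and integrability of all `(1+|r|)^m F(r)`; and the tail bound
  `∫_{|r| ≥ Δ} (1+|r|)^m |F(r)| dr ≤ 2^{m+2} D_k (2π)^{-k} Δ^{m+1-k}/(k-m-1)` for `Δ ≥ 1`,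
  `k ≥ m + 2` (`integral_tail_pow_mul_norm_windowKernel_le`), uniform in the window;
* reproducing moments (the Sobolev-type identity behind Radziwiłł's Lemma 1, [Radziwill2012] §2):
  `∫ (−2πir)^k F(r) e^{−2πiry} dr = f^{(k)}(y)` (`fourier_pow_smul_windowKernel`), so the zeroth
  moment is `1` on `[a+1, b]` and all higher moments vanish on the open flat part `(a+1, b)`;
* Plancherel for translates ([Radziwill2012], Lemma 3):
  `∫ F(t−γ) conj F(t−γ') dt = ∫ |f(y)|² e^{−2πiy(γ−γ')} dy` (`integral_windowKernel_mul_conj`), whence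
  `∫ |∑_γ c_γ F(t−γ)|² dt = ∫ |f(y)|² |∑_γ c_γ e(−yγ)|² dy ≤ ∫_a^{b+1} |∑_γ c_γ e(−yγ)|² dy`
  (`integral_normSq_sum_windowKernel_le`).

Everything is proved from Mathlib's Fourier inversion (`Continuous.fourier_fourierInv_eq`) and
the self-adjointness formula `∫ 𝓕h · g = ∫ h · 𝓕g`
(`VectorFourier.integral_fourierIntegral_smul_eq_flip`).

## References

* [Radziwill2012] M. Radziwiłł, *Limitations to mollifying ζ(s)*, arXiv:1207.6583, §2, Lemmas 1
  and 3, and §3 (the bound `f̂(x) ≪ (log T)(1 + |x| log T)^{-v}`).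
-/

noncomputable section

open Set MeasureTheory Complex Filter
open scoped ContDiff FourierTransform Real Topology ComplexConjugate

namespace Literature.Analysis.Fourier

open _root_.Real (fourierChar fourier_real_eq_integral_exp_smul fourierInv_eq_fourier_neg)

/-! ## General facts: Fourier decay from integrable derivatives -/

/-- `‖𝓕 g x‖ ≤ ∫ ‖g‖`. [folklore] -/
theorem norm_fourier_le_integral_norm (g : ℝ → ℂ) (x : ℝ) : ‖𝓕 g x‖ ≤ ∫ v, ‖g v‖ :=
  VectorFourier.norm_fourierIntegral_le_integral_norm 𝐞 volume (innerₗ ℝ) g x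

/-- `‖𝓕⁻ g x‖ ≤ ∫ ‖g‖`. [folklore] -/
theorem norm_fourierInv_le_integral_norm (g : ℝ → ℂ) (x : ℝ) : ‖𝓕⁻ g x‖ ≤ ∫ v, ‖g v‖ := by
  rw [fourierInv_eq_fourier_neg]
  exact norm_fourier_le_integral_norm g (-x)

/-- Decay of the Fourier transform of a `C^∞` function all of whose derivatives are integrable:
`(2π|x|)^k ‖𝓕 g x‖ ≤ ∫ ‖g^{(k)}‖`. [folklore] -/
theorem pow_mul_norm_fourier_le {g : ℝ → ℂ} (hg : ContDiff ℝ ∞ g)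
    (hint : ∀ n : ℕ, Integrable (iteratedDeriv n g)) (k : ℕ) (x : ℝ) :
    (2 * π * |x|) ^ k * ‖𝓕 g x‖ ≤ ∫ v, ‖iteratedDeriv k g v‖ := by
  have h := _root_.Real.fourier_iteratedDeriv (N := (⊤ : ℕ∞)) (n := k) hg
    (fun n _ => hint n) (by exact_mod_cast le_top)
  have hx : 𝓕 (iteratedDeriv k g) x = (2 * π * I * x) ^ k • 𝓕 g x := congrFun h x
  have hnorm : ‖𝓕 (iteratedDeriv k g) x‖ = (2 * π * |x|) ^ k * ‖𝓕 g x‖ := by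
    rw [hx, norm_smul, norm_pow]
    congr 2
    simp [abs_of_pos Real.pi_pos]
  rw [← hnorm]
  exact norm_fourier_le_integral_norm _ x

/-! ## The kernel of the smooth window -/

/-- The Fourier kernel `F = 𝓕⁻ f` of the smooth window `f = smoothWindow a b`:
`F(r) = ∫ f(y) e^{2πiyr} dy`. [cite: Radziwill2012, §2 Lemma 1 and §3] -/
def windowKernel (a b : ℝ) : ℝ → ℂ := 𝓕⁻ (smoothWindow a b)

/-- [folklore] -/
lemma windowKernel_eq (a b : ℝ) : windowKernel a b = 𝓕⁻ (smoothWindow a b) := rfl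

/-- `F(r) = 𝓕 f (−r)`. [folklore] -/
lemma windowKernel_apply_eq_fourier_neg (a b r : ℝ) :
    windowKernel a b r = 𝓕 (smoothWindow a b) (-r) := by
  rw [windowKernel_eq, fourierInv_eq_fourier_neg]

/-- `F(r) = ∫ e^{2πiyr} f(y) dy` explicitly. [folklore] -/
lemma windowKernel_apply (a b r : ℝ) :
    windowKernel a b r = ∫ y, Complex.exp (↑(2 * π * y * r) * I) • smoothWindow a b y := by
  rw [windowKernel_eq, _root_.Real.fourierInv_eq']
  congr 1; ext y
  simp [mul_comm r y, mul_assoc]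

/-- `|F(r)| ≤ b + 1 − a`. [folklore] -/
theorem norm_windowKernel_le {a b : ℝ} (hab : a ≤ b) (r : ℝ) : ‖windowKernel a b r‖ ≤ b + 1 - a :=
  (norm_fourierInv_le_integral_norm _ r).trans (integral_norm_smoothWindow_le hab)

/-- `(2π|r|)^k |F(r)| ≤ 2 D_k` for `k ≥ 1`, uniformly in the window. [cite: Radziwill2012, §3] -/
theorem pow_mul_norm_windowKernel_le {a b : ℝ} (hab : a ≤ b) {k : ℕ} (hk : k ≠ 0) (r : ℝ) :
    (2 * π * |r|) ^ k * ‖windowKernel a b r‖ ≤ 2 * stepDerivBound k := by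
  rw [windowKernel_apply_eq_fourier_neg]
  have h := pow_mul_norm_fourier_le (contDiff_smoothWindow a b)
    (integrable_iteratedDeriv_smoothWindow hab) k (-r)
  rw [abs_neg] at h
  exact h.trans (integral_norm_iteratedDeriv_smoothWindow_le hab hk)

/-- `|F(r)| ≤ 2 D_k / (2π|r|)^k` for `k ≥ 1`, `r ≠ 0`. [cite: Radziwill2012, §3] -/
theorem norm_windowKernel_le_div {a b : ℝ} (hab : a ≤ b) {k : ℕ} (hk : k ≠ 0) {r : ℝ}
    (hr : r ≠ 0) : ‖windowKernel a b r‖ ≤ 2 * stepDerivBound k / (2 * π * |r|) ^ k := by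
  have hpos : 0 < (2 * π * |r|) ^ k := by positivity
  rw [le_div_iff₀ hpos, mul_comm]
  exact pow_mul_norm_windowKernel_le hab hk r

/-- The kernel is continuous. [folklore] -/
theorem continuous_windowKernel {a b : ℝ} (hab : a ≤ b) : Continuous (windowKernel a b) := by
  have h : Continuous (𝓕 (smoothWindow a b)) :=
    VectorFourier.fourierIntegral_continuous Real.continuous_fourierChar
      (by exact continuous_inner) (integrable_smoothWindow hab)
  have : windowKernel a b = fun r => 𝓕 (smoothWindow a b) (-r) :=
    funext (windowKernel_apply_eq_fourier_neg a b)
  rw [this]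
  exact h.comp continuous_neg

/-- The constant `C_m(a,b) = 2^{m+1}(b+1−a) + 2^{m+2} D_{m+2} (2π)^{-(m+2)}` of the weighted decay
bound. [folklore] -/
def windowKernelConst (a b : ℝ) (m : ℕ) : ℝ :=
  2 ^ (m + 1) * (b + 1 - a) + 2 ^ (m + 2) * stepDerivBound (m + 2) / (2 * π) ^ (m + 2)

/-- [folklore] -/
lemma windowKernelConst_nonneg {a b : ℝ} (hab : a ≤ b) (m : ℕ) : 0 ≤ windowKernelConst a b m := by
  unfold windowKernelConst
  have := stepDerivBound_nonneg (m + 2)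
  have : 0 ≤ b + 1 - a := by linarith
  positivity

/-- Weighted decay: `(1 + |r|)^m |F(r)| ≤ C_m(a,b) / (1 + r²)`. [folklore] -/
theorem pow_mul_norm_windowKernel_le_div {a b : ℝ} (hab : a ≤ b) (m : ℕ) (r : ℝ) :
    (1 + |r|) ^ m * ‖windowKernel a b r‖ ≤ windowKernelConst a b m / (1 + r ^ 2) := by
  have hΛ : 0 ≤ b + 1 - a := by linarith
  have hF0 : 0 ≤ ‖windowKernel a b r‖ := norm_nonneg _
  have hD := stepDerivBound_nonneg (m + 2)
  have h1r2 : 0 < 1 + r ^ 2 := by positivity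
  rw [le_div_iff₀ h1r2]
  unfold windowKernelConst
  rcases le_or_gt |r| 1 with hr | hr
  · -- `|r| ≤ 1`: use `|F| ≤ b + 1 - a`
    have hb := norm_windowKernel_le hab r
    have h1 : (1 + |r|) ^ m ≤ 2 ^ m :=
      pow_le_pow_left₀ (by positivity) (by linarith) m
    have h2 : 1 + r ^ 2 ≤ 2 := by
      have : r ^ 2 = |r| ^ 2 := (sq_abs r).symm
      nlinarith [abs_nonneg r]
    have hA : 0 ≤ 2 ^ (m + 2) * stepDerivBound (m + 2) / (2 * π) ^ (m + 2) := by positivity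
    calc (1 + |r|) ^ m * ‖windowKernel a b r‖ * (1 + r ^ 2) ≤ 2 ^ m * (b + 1 - a) * 2 := by
          apply mul_le_mul (mul_le_mul h1 hb hF0 (by positivity)) h2 h1r2.le (by positivity)
      _ = 2 ^ (m + 1) * (b + 1 - a) := by ring
      _ ≤ _ := le_add_of_nonneg_right hA
  · -- `|r| > 1`: use `|F| ≤ 2 D_{m+2} / (2π|r|)^{m+2}`
    have hr0 : r ≠ 0 := fun h => by rw [h, abs_zero] at hr; linarith
    have hb := norm_windowKernel_le_div hab (k := m + 2) (by omega) hr0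
    have hrpos : 0 < |r| := by linarith
    have h1 : (1 + |r|) ^ m ≤ 2 ^ m * |r| ^ m := by
      rw [← mul_pow]; exact pow_le_pow_left₀ (by positivity) (by linarith) m
    have h2 : 1 + r ^ 2 ≤ 2 * |r| ^ 2 := by
      have : r ^ 2 = |r| ^ 2 := (sq_abs r).symm
      nlinarith
    have hpow : (2 * π * |r|) ^ (m + 2) = (2 * π) ^ (m + 2) * (|r| ^ m * |r| ^ 2) := by
      rw [mul_pow]; ring
    have h2π : 0 < (2 * π) ^ (m + 2) := by positivity
    calc (1 + |r|) ^ m * ‖windowKernel a b r‖ * (1 + r ^ 2)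
        ≤ (2 ^ m * |r| ^ m) * (2 * stepDerivBound (m + 2) / (2 * π * |r|) ^ (m + 2)) *
            (2 * |r| ^ 2) := by
          apply mul_le_mul (mul_le_mul h1 hb hF0 (by positivity)) h2 h1r2.le (by positivity)
      _ = 2 ^ (m + 2) * stepDerivBound (m + 2) / (2 * π) ^ (m + 2) := by
          rw [hpow]
          field_simp
          ring
      _ ≤ _ := le_add_of_nonneg_left (by positivity)

/-- `(1 + |r|)^m F(r)` is integrable for every `m`. [folklore] -/
theorem integrable_pow_mul_windowKernel {a b : ℝ} (hab : a ≤ b) (m : ℕ) :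
    Integrable fun r => ((1 + |r|) ^ m : ℝ) • windowKernel a b r := by
  have hmeas : AEStronglyMeasurable (fun r => ((1 + |r|) ^ m : ℝ) • windowKernel a b r) volume := by
    have : Continuous fun r => ((1 + |r|) ^ m : ℝ) • windowKernel a b r :=
      (by fun_prop : Continuous fun r : ℝ => (1 + |r|) ^ m).smul (continuous_windowKernel hab)
    exact this.aestronglyMeasurable
  refine Integrable.mono' ((integrable_inv_one_add_sq).const_mul (windowKernelConst a b m)) hmeas
    (ae_of_all _ fun r => ?_)
  rw [norm_smul, Real.norm_eq_abs, abs_of_nonneg (by positivity), ← div_eq_mul_inv]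
  exact pow_mul_norm_windowKernel_le_div hab m r

/-- The kernel is integrable. [folklore] -/
theorem integrable_windowKernel {a b : ℝ} (hab : a ≤ b) : Integrable (windowKernel a b) := by
  simpa using integrable_pow_mul_windowKernel hab 0

/-- `𝓕 f` is integrable (same decay). [folklore] -/
theorem integrable_fourier_smoothWindow {a b : ℝ} (hab : a ≤ b) :
    Integrable (𝓕 (smoothWindow a b)) := by
  have h : 𝓕 (smoothWindow a b) = fun r => windowKernel a b (-r) := by
    ext r; rw [windowKernel_apply_eq_fourier_neg, neg_neg]
  rw [h]
  exact (integrable_windowKernel hab).comp_neg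

/-- `∫ (1+|r|)^m |F(r)| dr ≤ π C_m(a,b)`. [folklore] -/
theorem integral_pow_mul_norm_windowKernel_le {a b : ℝ} (hab : a ≤ b) (m : ℕ) :
    ∫ r, (1 + |r|) ^ m * ‖windowKernel a b r‖ ≤ π * windowKernelConst a b m := by
  calc ∫ r, (1 + |r|) ^ m * ‖windowKernel a b r‖
      ≤ ∫ r : ℝ, windowKernelConst a b m * (1 + r ^ 2)⁻¹ := by
        apply integral_mono_of_nonneg (ae_of_all _ fun r => by positivity)
          ((integrable_inv_one_add_sq).const_mul _) (ae_of_all _ fun r => ?_)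
        simp only [← div_eq_mul_inv]
        exact pow_mul_norm_windowKernel_le_div hab m r
    _ = π * windowKernelConst a b m := by
        rw [integral_const_mul, integral_univ_inv_one_add_sq, mul_comm]

/-- `∫ |F| ≤ π C_0(a,b)`. [folklore] -/
theorem integral_norm_windowKernel_le {a b : ℝ} (hab : a ≤ b) :
    ∫ r, ‖windowKernel a b r‖ ≤ π * windowKernelConst a b 0 := by
  simpa using integral_pow_mul_norm_windowKernel_le hab 0


/-! ## Tail bounds, uniform in the window -/

/-- The constant of the tail bound: `2^{m+1} D_k (2π)^{-k} / (k − m − 1)`. [folklore] -/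
def windowTailConst (m k : ℕ) : ℝ :=
  2 ^ (m + 1) * stepDerivBound k / (2 * π) ^ k / ((k : ℝ) - m - 1)

/-- [folklore] -/
lemma windowTailConst_nonneg {m k : ℕ} (hk : m + 2 ≤ k) : 0 ≤ windowTailConst m k := by
  unfold windowTailConst
  have := stepDerivBound_nonneg k
  have hk' : (0 : ℝ) < (k : ℝ) - m - 1 := by
    have : (m : ℝ) + 2 ≤ k := by exact_mod_cast hk
    linarith
  positivity

/-- Pointwise tail majorant: for `|r| ≥ Δ ≥ 1` and `k ≥ 1`,
`(1+|r|)^m |F(r)| ≤ 2^{m+1} D_k (2π)^{-k} |r|^{m-k}`. [folklore] -/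
lemma pow_mul_norm_windowKernel_le_rpow {a b : ℝ} (hab : a ≤ b) {m k : ℕ} (hk : k ≠ 0)
    {Δ r : ℝ} (hΔ : 1 ≤ Δ) (hr : Δ ≤ |r|) :
    (1 + |r|) ^ m * ‖windowKernel a b r‖ ≤
      2 ^ (m + 1) * stepDerivBound k / (2 * π) ^ k * |r| ^ ((m : ℝ) - k) := by
  have hr1 : 1 ≤ |r| := hΔ.trans hr
  have hr0 : r ≠ 0 := fun h => by rw [h, abs_zero] at hr1; linarith
  have hrpos : 0 < |r| := by linarith
  have hb := norm_windowKernel_le_div hab hk hr0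
  have hD := stepDerivBound_nonneg k
  have h1 : (1 + |r|) ^ m ≤ 2 ^ m * |r| ^ m := by
    rw [← mul_pow]; exact pow_le_pow_left₀ (by positivity) (by linarith) m
  have hrpow : |r| ^ ((m : ℝ) - k) = |r| ^ m / |r| ^ k := by
    rw [Real.rpow_sub hrpos, Real.rpow_natCast, Real.rpow_natCast]
  rw [hrpow]
  calc (1 + |r|) ^ m * ‖windowKernel a b r‖
      ≤ (2 ^ m * |r| ^ m) * (2 * stepDerivBound k / (2 * π * |r|) ^ k) :=
        mul_le_mul h1 hb (norm_nonneg _) (by positivity)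
    _ = 2 ^ (m + 1) * stepDerivBound k / (2 * π) ^ k * (|r| ^ m / |r| ^ k) := by
        rw [mul_pow]
        field_simp
        ring

/-- `∫_Δ^∞ r^{m-k} dr = Δ^{m+1-k}/(k-m-1)` for `k ≥ m + 2`, `Δ > 0`, in the form used below.
[folklore] -/
lemma integral_Ioi_rpow_sub {m k : ℕ} (hk : m + 2 ≤ k) {Δ : ℝ} (hΔ : 0 < Δ) :
    ∫ r in Ioi Δ, r ^ ((m : ℝ) - k) = Δ ^ ((m : ℝ) + 1 - k) / ((k : ℝ) - m - 1) := by
  have hlt : (m : ℝ) - k < -1 := by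
    have : (m : ℝ) + 2 ≤ k := by exact_mod_cast hk
    linarith
  rw [integral_Ioi_rpow_of_lt hlt hΔ]
  have hne : (m : ℝ) - k + 1 ≠ 0 := by linarith
  have hne' : (k : ℝ) - m - 1 ≠ 0 := by linarith
  rw [show (m : ℝ) + 1 - k = (m : ℝ) - k + 1 by ring]
  field_simp
  ring

/-- **Right tail.** For `Δ ≥ 1` and `k ≥ m + 2`:
`∫_{r > Δ} (1+|r|)^m |F(r)| dr ≤ windowTailConst m k · Δ^{m+1-k}`, uniformly in the window.
[cite: Radziwill2012, §3] -/
theorem integral_Ioi_pow_mul_norm_windowKernel_le {a b : ℝ} (hab : a ≤ b) {m k : ℕ}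
    (hk : m + 2 ≤ k) {Δ : ℝ} (hΔ : 1 ≤ Δ) :
    ∫ r in Ioi Δ, (1 + |r|) ^ m * ‖windowKernel a b r‖ ≤
      windowTailConst m k * Δ ^ ((m : ℝ) + 1 - k) := by
  have hΔ0 : 0 < Δ := by linarith
  have hk0 : k ≠ 0 := by omega
  have hlt : (m : ℝ) - k < -1 := by
    have : (m : ℝ) + 2 ≤ k := by exact_mod_cast hk
    linarith
  set C : ℝ := 2 ^ (m + 1) * stepDerivBound k / (2 * π) ^ k with hC
  have hC0 : 0 ≤ C := by have := stepDerivBound_nonneg k; positivity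
  have hint : IntegrableOn (fun r : ℝ => C * r ^ ((m : ℝ) - k)) (Ioi Δ) :=
    (integrableOn_Ioi_rpow_of_lt hlt hΔ0).const_mul C
  calc ∫ r in Ioi Δ, (1 + |r|) ^ m * ‖windowKernel a b r‖
      ≤ ∫ r in Ioi Δ, C * r ^ ((m : ℝ) - k) := by
        refine integral_mono_of_nonneg (ae_of_all _ fun r => by positivity) hint ?_
        rw [EventuallyLE, ae_restrict_iff' measurableSet_Ioi]
        refine ae_of_all _ fun r (hr : Δ < r) => ?_
        have hrr : |r| = r := abs_of_pos (hΔ0.trans hr)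
        have := pow_mul_norm_windowKernel_le_rpow hab (m := m) hk0 hΔ (by rw [hrr]; exact hr.le)
        rw [hrr] at this ⊢
        rw [hC]; exact this
    _ = windowTailConst m k * Δ ^ ((m : ℝ) + 1 - k) := by
        rw [integral_const_mul, integral_Ioi_rpow_sub hk hΔ0, hC, windowTailConst]
        field_simp

/-- **Left tail.** For `Δ ≥ 1` and `k ≥ m + 2`:
`∫_{r < -Δ} (1+|r|)^m |F(r)| dr ≤ windowTailConst m k · Δ^{m+1-k}`, uniformly in the window.
[cite: Radziwill2012, §3] -/
theorem integral_Iio_pow_mul_norm_windowKernel_le {a b : ℝ} (hab : a ≤ b) {m k : ℕ}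
    (hk : m + 2 ≤ k) {Δ : ℝ} (hΔ : 1 ≤ Δ) :
    ∫ r in Iio (-Δ), (1 + |r|) ^ m * ‖windowKernel a b r‖ ≤
      windowTailConst m k * Δ ^ ((m : ℝ) + 1 - k) := by
  have hΔ0 : 0 < Δ := by linarith
  have hk0 : k ≠ 0 := by omega
  have hlt : (m : ℝ) - k < -1 := by
    have : (m : ℝ) + 2 ≤ k := by exact_mod_cast hk
    linarith
  set C : ℝ := 2 ^ (m + 1) * stepDerivBound k / (2 * π) ^ k with hC
  have hC0 : 0 ≤ C := by have := stepDerivBound_nonneg k; positivity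
  -- the majorant `C |r|^{m-k}` on `Iio (-Δ)` and its integral, by reflection
  set g : ℝ → ℝ := fun r => C * |r| ^ ((m : ℝ) - k) with hg
  have hgsymm : (fun r => g (-r)) = g := by ext r; simp [hg, abs_neg]
  have hint' : IntegrableOn g (Ioi Δ) := by
    refine IntegrableOn.congr_fun ((integrableOn_Ioi_rpow_of_lt hlt hΔ0).const_mul C)
      (fun r hr => ?_) measurableSet_Ioi
    simp only [hg, abs_of_pos (hΔ0.trans hr)]
  have hint : IntegrableOn g (Iio (-Δ)) := by
    have h := hint'.comp_neg
    rw [Set.neg_Ioi, hgsymm] at h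
    exact h
  have hval : ∫ r in Iio (-Δ), g r = C * (Δ ^ ((m : ℝ) + 1 - k) / ((k : ℝ) - m - 1)) := by
    rw [← integral_Iic_eq_integral_Iio, ← hgsymm, integral_comp_neg_Iic, neg_neg]
    calc ∫ r in Ioi Δ, g r = ∫ r in Ioi Δ, C * r ^ ((m : ℝ) - k) := by
          refine setIntegral_congr_fun measurableSet_Ioi fun r hr => ?_
          simp only [hg, abs_of_pos (hΔ0.trans hr)]
      _ = _ := by rw [integral_const_mul, integral_Ioi_rpow_sub hk hΔ0]
  calc ∫ r in Iio (-Δ), (1 + |r|) ^ m * ‖windowKernel a b r‖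
      ≤ ∫ r in Iio (-Δ), g r := by
        refine integral_mono_of_nonneg (ae_of_all _ fun r => by positivity) hint ?_
        rw [EventuallyLE, ae_restrict_iff' measurableSet_Iio]
        refine ae_of_all _ fun r (hr : r < -Δ) => ?_
        have hrr : Δ ≤ |r| := by rw [abs_of_neg (by linarith)]; linarith
        exact pow_mul_norm_windowKernel_le_rpow hab (m := m) hk0 hΔ hrr
    _ = windowTailConst m k * Δ ^ ((m : ℝ) + 1 - k) := by
        rw [hval, hC, windowTailConst]
        field_simp

/-! ## Reproducing moments (Radziwiłł's Lemma 1) -/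

/-- `𝓕⁻ (f^{(k)}) (r) = (−2πir)^k F(r)`. [folklore] -/
theorem fourierInv_iteratedDeriv_smoothWindow {a b : ℝ} (hab : a ≤ b) (k : ℕ) (r : ℝ) :
    𝓕⁻ (iteratedDeriv k (smoothWindow a b)) r = (-(2 * π * I * r)) ^ k • windowKernel a b r := by
  have h := _root_.Real.fourier_iteratedDeriv (N := (⊤ : ℕ∞)) (n := k) (contDiff_smoothWindow a b)
    (fun n _ => integrable_iteratedDeriv_smoothWindow hab n) (by exact_mod_cast le_top)
  rw [fourierInv_eq_fourier_neg, congrFun h (-r), windowKernel_apply_eq_fourier_neg]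
  congr 1
  push_cast
  ring

/-- `𝓕 (f^{(k)})` is integrable. [folklore] -/
theorem integrable_fourier_iteratedDeriv_smoothWindow {a b : ℝ} (hab : a ≤ b) (k : ℕ) :
    Integrable (𝓕 (iteratedDeriv k (smoothWindow a b))) := by
  have h := _root_.Real.fourier_iteratedDeriv (N := (⊤ : ℕ∞)) (n := k) (contDiff_smoothWindow a b)
    (fun n _ => integrable_iteratedDeriv_smoothWindow hab n) (by exact_mod_cast le_top)
  rw [h]
  -- dominated by `(2π)^k (1 + |x|)^k |F(-x)|`
  have hdom : Integrable fun x : ℝ => ((1 + |x|) ^ k : ℝ) • windowKernel a b (-x) := by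
    have := (integrable_pow_mul_windowKernel hab k).comp_neg
    simpa [abs_neg] using this
  have hmeas : AEStronglyMeasurable (fun x : ℝ => (2 * π * I * x) ^ k • 𝓕 (smoothWindow a b) x)
      volume := by
    have hc : Continuous fun x : ℝ => (2 * π * I * x) ^ k • 𝓕 (smoothWindow a b) x := by
      have h1 : Continuous (𝓕 (smoothWindow a b)) :=
        VectorFourier.fourierIntegral_continuous Real.continuous_fourierChar
          (by exact continuous_inner) (integrable_smoothWindow hab)
      exact ((continuous_const.mul continuous_ofReal).pow k).smul h1
    exact hc.aestronglyMeasurable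
  refine Integrable.mono' ((hdom.norm).const_mul ((2 * π) ^ k)) hmeas (ae_of_all _ fun x => ?_)
  rw [norm_smul, norm_smul, norm_pow, Real.norm_eq_abs, abs_of_nonneg (by positivity),
    windowKernel_apply_eq_fourier_neg, neg_neg]
  have hn : ‖2 * π * I * x‖ = 2 * π * |x| := by simp [abs_of_pos Real.pi_pos]
  rw [hn, mul_pow]
  have hx : |x| ^ k ≤ (1 + |x|) ^ k := pow_le_pow_left₀ (abs_nonneg x) (by linarith [abs_nonneg x]) k
  have := norm_nonneg (𝓕 (smoothWindow a b) x)
  nlinarith [mul_le_mul_of_nonneg_right hx this, pow_nonneg (by positivity : (0:ℝ) ≤ 2 * π) k]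

/-- **Reproducing moments** (the identity behind Radziwiłł's Lemma 1): the Fourier transform of
`(−2πir)^k F(r)` is `f^{(k)}`, i.e. `∫ e^{−2πiry} (−2πir)^k F(r) dr = f^{(k)}(y)` for all `y`.
[cite: Radziwill2012, §2 Lemma 1] -/
theorem fourier_pow_smul_windowKernel {a b : ℝ} (hab : a ≤ b) (k : ℕ) :
    𝓕 (fun r : ℝ => (-(2 * π * I * r)) ^ k • windowKernel a b r) =
      iteratedDeriv k (smoothWindow a b) := by
  have heq : (fun r : ℝ => (-(2 * π * I * r)) ^ k • windowKernel a b r) =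
      𝓕⁻ (iteratedDeriv k (smoothWindow a b)) :=
    funext fun r => (fourierInv_iteratedDeriv_smoothWindow hab k r).symm
  rw [heq]
  exact (continuous_iteratedDeriv_smoothWindow a b k).fourier_fourierInv_eq
    (integrable_iteratedDeriv_smoothWindow hab k) (integrable_fourier_iteratedDeriv_smoothWindow hab k)

/-- The moment identity written as an integral:
`∫ e^{−2πiry} (−2πir)^k F(r) dr = f^{(k)}(y)`. [cite: Radziwill2012, §2 Lemma 1] -/
theorem integral_exp_smul_pow_smul_windowKernel {a b : ℝ} (hab : a ≤ b) (k : ℕ) (y : ℝ) :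
    ∫ r : ℝ, Complex.exp (↑(-2 * π * r * y) * I) • ((-(2 * π * I * r)) ^ k • windowKernel a b r) =
      iteratedDeriv k (smoothWindow a b) y := by
  rw [← congrFun (fourier_pow_smul_windowKernel hab k) y, fourier_real_eq_integral_exp_smul]

/-- Zeroth moment: `∫ e^{−2πiry} F(r) dr = f(y)`, `= 1` on the flat part `[a+1, b]`.
[cite: Radziwill2012, §2 Lemma 1] -/
theorem integral_exp_mul_windowKernel_eq_one {a b y : ℝ} (h1 : a + 1 ≤ y) (h2 : y ≤ b) :
    ∫ r : ℝ, Complex.exp (↑(-2 * π * r * y) * I) * windowKernel a b r = 1 := by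
  have hab : a ≤ b := by linarith
  have h := integral_exp_smul_pow_smul_windowKernel hab 0 y
  simp only [pow_zero, smul_eq_mul, one_mul, iteratedDeriv_zero] at h
  rw [h, smoothWindow_eq_one h1 h2]

/-- Higher moments vanish on the open flat part: for `k ≥ 1` and `a + 1 < y < b`,
`∫ e^{−2πiry} r^k F(r) dr = 0`. [cite: Radziwill2012, §2 Lemma 1] -/
theorem integral_exp_mul_pow_mul_windowKernel_eq_zero {a b : ℝ} {k : ℕ} (hk : k ≠ 0) {y : ℝ}
    (h1 : a + 1 < y) (h2 : y < b) :
    ∫ r : ℝ, Complex.exp (↑(-2 * π * r * y) * I) * ((r : ℂ) ^ k * windowKernel a b r) = 0 := by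
  have hab : a ≤ b := by linarith
  have h := integral_exp_smul_pow_smul_windowKernel hab k y
  rw [iteratedDeriv_smoothWindow_eq_zero hk h1 h2] at h
  have hc : (-(2 * π * I)) ^ k ≠ 0 := by
    apply pow_ne_zero
    simp [Real.pi_ne_zero, I_ne_zero]
  have hrw : (fun r : ℝ => Complex.exp (↑(-2 * π * r * y) * I) •
      ((-(2 * π * I * r)) ^ k • windowKernel a b r)) = fun r : ℝ => (-(2 * π * I)) ^ k *
      (Complex.exp (↑(-2 * π * r * y) * I) * ((r : ℂ) ^ k * windowKernel a b r)) := by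
    ext r; simp only [smul_eq_mul]; ring
  rw [hrw, integral_const_mul] at h
  exact (mul_eq_zero.1 h).resolve_left hc

/-- Zeroth moment in "frequency" form: if `L/(2π) ∈ [a+1, b]` then `∫ e^{−irL} F(r) dr = 1`.
[cite: Radziwill2012, §2 Lemma 1] -/
theorem integral_exp_neg_mul_windowKernel_eq_one {a b L : ℝ} (h1 : a + 1 ≤ L / (2 * π))
    (h2 : L / (2 * π) ≤ b) :
    ∫ r : ℝ, Complex.exp (↑(-(r * L)) * I) * windowKernel a b r = 1 := by
  rw [← integral_exp_mul_windowKernel_eq_one h1 h2]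
  congr 1; ext r
  congr 3
  push_cast
  field_simp

/-- Higher moments in "frequency" form: if `L/(2π) ∈ (a+1, b)` and `k ≥ 1` then
`∫ e^{−irL} r^k F(r) dr = 0`. [cite: Radziwill2012, §2 Lemma 1] -/
theorem integral_exp_neg_mul_pow_mul_windowKernel_eq_zero {a b L : ℝ} {k : ℕ} (hk : k ≠ 0)
    (h1 : a + 1 < L / (2 * π)) (h2 : L / (2 * π) < b) :
    ∫ r : ℝ, Complex.exp (↑(-(r * L)) * I) * ((r : ℂ) ^ k * windowKernel a b r) = 0 := by
  rw [← integral_exp_mul_pow_mul_windowKernel_eq_zero hk h1 h2]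
  congr 1; ext r
  congr 3
  push_cast
  field_simp

/-! ## Plancherel for translates of the kernel (Radziwiłł's Lemma 3) -/

/-- `conj F(x) = 𝓕 (conj ∘ f)(x)`. [folklore] -/
lemma conj_windowKernel (a b x : ℝ) :
    conj (windowKernel a b x) = 𝓕 (fun y => conj (smoothWindow a b y)) x := by
  rw [windowKernel_apply, fourier_real_eq_integral_exp_smul, ← integral_conj]
  congr 1; ext y
  simp only [smul_eq_mul, map_mul, ← Complex.exp_conj, map_mul, Complex.conj_ofReal, Complex.conj_I]
  congr 1
  push_cast
  ring

/-- `conj F(r + c) = 𝓕 h (r)` with `h(y) = e^{−2πiyc} conj f(y)`. [folklore] -/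
lemma conj_windowKernel_add (a b r c : ℝ) :
    conj (windowKernel a b (r + c)) =
      𝓕 (fun y : ℝ => Complex.exp (↑(-2 * π * y * c) * I) * conj (smoothWindow a b y)) r := by
  rw [conj_windowKernel, fourier_real_eq_integral_exp_smul, fourier_real_eq_integral_exp_smul]
  congr 1; ext y
  simp only [smul_eq_mul]
  rw [← mul_assoc, ← Complex.exp_add]
  congr 2
  push_cast
  ring

/-- `(innerₗ ℝ).flip = innerₗ ℝ` (the real inner product on `ℝ` is symmetric). [folklore] -/
lemma innerₗ_real_flip : (innerₗ ℝ).flip = innerₗ ℝ := by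
  refine LinearMap.ext fun x => LinearMap.ext fun y => ?_
  simp only [LinearMap.flip_apply, innerₗ_apply_apply, real_inner_comm]

/-- The self-adjointness formula on `ℝ`: `∫ 𝓕h · g = ∫ h · 𝓕g` for integrable `h, g`. [folklore] -/
theorem integral_fourier_mul_eq_integral_mul_fourier {h g : ℝ → ℂ} (hh : Integrable h)
    (hg : Integrable g) : ∫ r, 𝓕 h r * g r = ∫ y, h y * 𝓕 g y := by
  have := VectorFourier.integral_fourierIntegral_smul_eq_flip (L := innerₗ ℝ) (μ := volume)
    (ν := volume) Real.continuous_fourierChar (by exact continuous_inner) hh hg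
  simp only [smul_eq_mul] at this
  rw [innerₗ_real_flip] at this
  exact this

/-- **Plancherel for two translates of the kernel:**
`∫ F(t−γ) conj F(t−γ') dt = ∫ e^{−2πiy(γ−γ')} |f(y)|² dy`. [cite: Radziwill2012, §2 Lemma 3] -/
theorem integral_windowKernel_mul_conj {a b : ℝ} (hab : a ≤ b) (γ γ' : ℝ) :
    ∫ t, windowKernel a b (t - γ) * conj (windowKernel a b (t - γ')) =
      ∫ y : ℝ, Complex.exp (↑(-2 * π * y * (γ - γ')) * I) * (‖smoothWindow a b y‖ ^ 2 : ℝ) := by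
  set f := smoothWindow a b with hf
  set F := windowKernel a b with hF
  set c := γ - γ' with hc
  -- substitute `t = r + γ`
  have hsub : ∫ t, F (t - γ) * conj (F (t - γ')) = ∫ r, F r * conj (F (r + c)) := by
    rw [← integral_add_right_eq_self (fun t => F (t - γ) * conj (F (t - γ'))) γ]
    congr 1; ext r
    rw [hc, add_sub_cancel_right, show r + γ - γ' = r + (γ - γ') by ring]
  rw [hsub]
  set h : ℝ → ℂ := fun y => Complex.exp (↑(-2 * π * y * c) * I) * conj (f y) with hh
  have hconj : ∀ r, conj (F (r + c)) = 𝓕 h r := fun r => conj_windowKernel_add a b r c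
  simp_rw [hconj]
  have hhi : Integrable h := by
    refine Continuous.integrable_of_hasCompactSupport ?_ ?_
    · rw [hh]
      exact (by fun_prop : Continuous fun y : ℝ => Complex.exp (↑(-2 * π * y * c) * I)).mul
        (Complex.continuous_conj.comp (continuous_smoothWindow a b))
    · rw [hh]
      exact ((hasCompactSupport_smoothWindow hab).comp_left (g := fun z : ℂ => conj z)
        (map_zero _)).mul_left
  calc ∫ r, F r * 𝓕 h r = ∫ r, 𝓕 h r * F r := by congr 1; ext r; ring
    _ = ∫ y, h y * 𝓕 F y := integral_fourier_mul_eq_integral_mul_fourier hhi (integrable_windowKernel hab)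
    _ = ∫ y, h y * f y := by
        rw [hF, windowKernel_eq, (continuous_smoothWindow a b).fourier_fourierInv_eq
          (integrable_smoothWindow hab) (integrable_fourier_smoothWindow hab)]
    _ = _ := by
        congr 1; ext y
        rw [hh]; simp only
        rw [mul_assoc, mul_comm (conj (f y)) (f y), Complex.mul_conj, Complex.normSq_eq_norm_sq]


/-! ## Plancherel for finite combinations of translates -/

/-- `t ↦ F(t − γ) conj F(t − γ')` is integrable. [folklore] -/
lemma integrable_windowKernel_sub_mul_conj {a b : ℝ} (hab : a ≤ b) (γ γ' : ℝ) :
    Integrable fun t => windowKernel a b (t - γ) * conj (windowKernel a b (t - γ')) := by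
  refine ((integrable_windowKernel hab).comp_sub_right γ).mul_bdd (c := b + 1 - a) ?_
    (ae_of_all _ fun t => ?_)
  · exact (Complex.continuous_conj.comp ((continuous_windowKernel hab).comp
      (continuous_id.sub continuous_const))).aestronglyMeasurable
  · rw [Complex.norm_conj]; exact norm_windowKernel_le hab _

/-- Pointwise expansion of `|∑_i c_i z_i|²` as a double sum, in `ℂ`. [folklore] -/
lemma normSq_sum_eq_sum_sum {ι : Type*} (S : Finset ι) (z : ι → ℂ) :
    ((‖∑ i ∈ S, z i‖ ^ 2 : ℝ) : ℂ) = ∑ i ∈ S, ∑ j ∈ S, z i * conj (z j) := by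
  rw [← Complex.normSq_eq_norm_sq, ← Complex.mul_conj, map_sum, Finset.sum_mul_sum]

/-- **Plancherel for a finite combination of translates of the kernel:**
`∫ |∑_i c_i F(t − γ_i)|² dt = ∫ |f(y)|² |∑_i c_i e(−yγ_i)|² dy` (`e(x) = exp(2πix)`).
[cite: Radziwill2012, §2 Lemma 3] -/
theorem integral_normSq_sum_windowKernel {a b : ℝ} (hab : a ≤ b) {ι : Type*} (S : Finset ι)
    (γ : ι → ℝ) (c : ι → ℂ) :
    ∫ t, ‖∑ i ∈ S, c i * windowKernel a b (t - γ i)‖ ^ 2 =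
      ∫ y, ‖smoothWindow a b y‖ ^ 2 * ‖∑ i ∈ S, c i * Complex.exp (↑(2 * π * (-(y * γ i))) * I)‖ ^ 2 := by
  set f := smoothWindow a b with hf
  set F := windowKernel a b with hF
  apply Complex.ofReal_injective
  rw [← integral_complex_ofReal, ← integral_complex_ofReal]
  -- expand the left-hand side
  have hL : ∀ t, (((‖∑ i ∈ S, c i * F (t - γ i)‖ ^ 2 : ℝ)) : ℂ) =
      ∑ i ∈ S, ∑ j ∈ S, (c i * conj (c j)) * (F (t - γ i) * conj (F (t - γ j))) := by
    intro t
    rw [normSq_sum_eq_sum_sum]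
    refine Finset.sum_congr rfl fun i _ => Finset.sum_congr rfl fun j _ => ?_
    rw [map_mul]; ring
  simp_rw [hL]
  have hint : ∀ i j, Integrable fun t => (c i * conj (c j)) * (F (t - γ i) * conj (F (t - γ j))) :=
    fun i j => (integrable_windowKernel_sub_mul_conj hab (γ i) (γ j)).const_mul _
  rw [integral_finsetSum _ (fun i _ => integrable_finsetSum _ fun j _ => hint i j)]
  have stepL : ∀ i ∈ S, ∫ t, ∑ j ∈ S, (c i * conj (c j)) * (F (t - γ i) * conj (F (t - γ j))) =
      ∑ j ∈ S, (c i * conj (c j)) *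
        ∫ y : ℝ, Complex.exp (↑(-2 * π * y * (γ i - γ j)) * I) * (‖f y‖ ^ 2 : ℝ) := by
    intro i _
    rw [integral_finsetSum _ (fun j _ => hint i j)]
    refine Finset.sum_congr rfl fun j _ => ?_
    rw [integral_const_mul, hF, integral_windowKernel_mul_conj hab]
  rw [Finset.sum_congr rfl stepL]
  -- expand the right-hand side
  have hR : ∀ y, (((‖f y‖ ^ 2 * ‖∑ i ∈ S, c i * Complex.exp (↑(2 * π * (-(y * γ i))) * I)‖ ^ 2 :
      ℝ)) : ℂ) = ∑ i ∈ S, ∑ j ∈ S, (c i * conj (c j)) *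
        (Complex.exp (↑(-2 * π * y * (γ i - γ j)) * I) * ((‖f y‖ ^ 2 : ℝ) : ℂ)) := by
    intro y
    rw [Complex.ofReal_mul, normSq_sum_eq_sum_sum, Finset.mul_sum]
    refine Finset.sum_congr rfl fun i _ => ?_
    rw [Finset.mul_sum]
    refine Finset.sum_congr rfl fun j _ => ?_
    rw [map_mul, ← Complex.exp_conj, map_mul, Complex.conj_ofReal, Complex.conj_I]
    have : Complex.exp (↑(-2 * π * y * (γ i - γ j)) * I) =
        Complex.exp (↑(2 * π * -(y * γ i)) * I) * Complex.exp (↑(2 * π * -(y * γ j)) * -I) := by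
      rw [← Complex.exp_add]; congr 1; push_cast; ring
    rw [this]; ring
  simp_rw [hR]
  have hint' : ∀ i j, Integrable fun y => (c i * conj (c j)) *
      (Complex.exp (↑(-2 * π * y * (γ i - γ j)) * I) * ((‖f y‖ ^ 2 : ℝ) : ℂ)) := by
    intro i j
    refine Integrable.const_mul ?_ _
    refine Integrable.bdd_mul (c := 1) ?_ ?_ (ae_of_all _ fun y => ?_)
    · refine ((integrable_smoothWindow hab).norm.ofReal).mono' ?_ (ae_of_all _ fun y => ?_)
      · exact (Complex.continuous_ofReal.comp
          ((continuous_smoothWindow a b).norm.pow 2)).aestronglyMeasurable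
      · rw [Complex.norm_real, Real.norm_eq_abs, abs_of_nonneg (by positivity), sq]
        exact mul_le_of_le_one_left (norm_nonneg _) (norm_smoothWindow_le_one hab y)
    · exact (by fun_prop : Continuous fun y : ℝ =>
        Complex.exp (↑(-2 * π * y * (γ i - γ j)) * I)).aestronglyMeasurable
    · rw [Complex.norm_exp_ofReal_mul_I]
  rw [integral_finsetSum _ (fun i _ => integrable_finsetSum _ fun j _ => hint' i j)]
  refine Finset.sum_congr rfl fun i _ => ?_
  rw [integral_finsetSum _ (fun j _ => hint' i j)]
  refine Finset.sum_congr rfl fun j _ => ?_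
  rw [integral_const_mul]

/-- `t ↦ |∑_i c_i F(t − γ_i)|²` is integrable. [folklore] -/
theorem integrable_normSq_sum_windowKernel {a b : ℝ} (hab : a ≤ b) {ι : Type*} (S : Finset ι)
    (γ : ι → ℝ) (c : ι → ℂ) :
    Integrable fun t => ‖∑ i ∈ S, c i * windowKernel a b (t - γ i)‖ ^ 2 := by
  set F := windowKernel a b with hF
  have hC : ∀ t, ‖∑ i ∈ S, c i * F (t - γ i)‖ ^ 2 =
      (∑ i ∈ S, ∑ j ∈ S, (c i * conj (c j)) * (F (t - γ i) * conj (F (t - γ j)))).re := by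
    intro t
    rw [← Complex.ofReal_re (‖_‖ ^ 2), normSq_sum_eq_sum_sum]
    congr 1
    refine Finset.sum_congr rfl fun i _ => Finset.sum_congr rfl fun j _ => ?_
    rw [map_mul]; ring
  simp_rw [hC]
  exact (integrable_finsetSum _ fun i _ => integrable_finsetSum _ fun j _ =>
    (integrable_windowKernel_sub_mul_conj hab (γ i) (γ j)).const_mul _).re

/-- **The `L²` norm of a combination of translates is controlled by the exponential sum over
the support of the window:** `∫ |∑_i c_i F(t − γ_i)|² dt ≤ ∫_a^{b+1} |∑_i c_i e(−yγ_i)|² dy`.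
[cite: Radziwill2012, §2 Lemma 3] -/
theorem integral_normSq_sum_windowKernel_le {a b : ℝ} (hab : a ≤ b) {ι : Type*} (S : Finset ι)
    (γ : ι → ℝ) (c : ι → ℂ) :
    ∫ t, ‖∑ i ∈ S, c i * windowKernel a b (t - γ i)‖ ^ 2 ≤
      ∫ y in a..(b + 1), ‖∑ i ∈ S, c i * Complex.exp (↑(2 * π * (-(y * γ i))) * I)‖ ^ 2 := by
  rw [integral_normSq_sum_windowKernel hab S γ c]
  set E : ℝ → ℝ := fun y => ‖∑ i ∈ S, c i * Complex.exp (↑(2 * π * (-(y * γ i))) * I)‖ ^ 2 with hE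
  have hEc : Continuous E := by
    rw [hE]
    refine (continuous_finsetSum _ fun i _ => ?_).norm.pow 2
    exact continuous_const.mul (by fun_prop)
  have hab1 : a ≤ b + 1 := by linarith
  rw [intervalIntegral.integral_of_le hab1, ← integral_Icc_eq_integral_Ioc,
    ← integral_indicator measurableSet_Icc]
  refine integral_mono_of_nonneg (ae_of_all _ fun y => by positivity) ?_ (ae_of_all _ fun y => ?_)
  · exact (hEc.integrableOn_Icc (a := a) (b := b + 1)).integrable_indicator measurableSet_Icc
  · change ‖smoothWindow a b y‖ ^ 2 * E y ≤ (Icc a (b + 1)).indicator E y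
    by_cases hy : y ∈ Icc a (b + 1)
    · rw [indicator_of_mem hy]
      have h1 : ‖smoothWindow a b y‖ ^ 2 ≤ 1 := by
        rw [sq]; exact mul_le_one₀ (norm_smoothWindow_le_one hab y) (norm_nonneg _)
          (norm_smoothWindow_le_one hab y)
      have hE0 : 0 ≤ E y := by rw [hE]; positivity
      nlinarith
    · rw [indicator_of_notMem hy]
      have : smoothWindow a b y = 0 := by
        by_contra h
        exact hy (support_smoothWindow_subset hab (Function.mem_support.2 h))
      rw [this, norm_zero]; ring_nf; rfl

end Literature.Analysis.Fourier
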